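import Summits.QuantumFields.YangMills.Theorems.UnitScaleTiltProp8ChartDoubleBarDefs
import HarnessLib

/-!
# Route `UnitScaleTilt`, crux K1 «MinimiserStabilityRegPr» (stmt-QuantumFields-19200) — the double-bar chart of record (★★OWNER RULING g26-№6 (R1)):
# **PRINT'S FUNDAMENTAL EQUALITY (92)∕(97)∕(99) FOR THE CELL'S SYMMETRIC CENTRED OBJECTS AT BACKGROUND 1 —
# the recomputed-frame iterate `dbarIterU` IS the single-bar iterate `emlIterU` conjugated by the ACCUMULATED block frames**

Cell `ym3-torus` (HUMAN RULING D-0037, YM ladder rung R3 — continuum SU(2) YM₃ on the torus is a RUNG, not the Clay problem), explicit-unit helper seat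
`ym-ust-19936-w8` gen 0, row (c1) of ★★OWNER ACK 25 (the (J1)∕(J2) companion of RULING g26-№12 (1)).  `--supports stmt-QuantumFields-19200 --as helper`;
def-free, 0 sorry, standard axioms.  Counts toward nothing by itself.

WHY.  [Balaban1985Averaging] Sect. C defines the `k`-th order double-bar average in TWO ways and proves they agree: (i) RECOMPUTED frames, level by level —
«`U̿₁^{j+1} = \overline{\overline{U̿₁^{j}}}`» with the frames of (89) taken from the previous double-bar level (the cell's `dbarIterU (k+1) U = dbarAvgU (dbarIterU k U)`,
✓`…ChartDoubleBarDefs`); (ii) ACCUMULATED frames — the `k`-fold SINGLE-bar average conjugated once by the product of the successive frames, (97) «`v_j(x) =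
(\overline{R_{0,x}U₁})(\overline{R̄_{0,x}U̿₁})·…·(\overline{R̄^{j−1}_{0,x}U̿₁^{j−1}})`», and (92)∕(99) «`(\overline{R_{0,b₋}U₁^{(k)}})⁻¹ Ũ₁^k R̄^k_{0,b} \overline{R_{0,b₊}U₁^{(k)}}
= (U̿₁^k)_b`».  At background `U₀ = 1` (the H side's chart of record, RULING №6; the rotations `R̄` are trivial) this file proves exactly that identity for the cell's
symmetric, centre-anchored objects (`emlAvgU`∕`vframeU` over the index family `Idx P`): for ANY family `V j : T^{(j)} → 𝔸ˣ` obeying the displayed recursion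
`V 0 = 1`, `V (j+1) y = V j (emb y) · vframeU (dbarIterU j U) y` (older frames on the LEFT, as in (97)),
  `dbarIterU j U = (emlIterU j U)^{V_j⁻¹}`, i.e. `U̿^{(j)}(c) = V_j(c₋)⁻¹ · Ū^{(j)}(c) · V_j(c₊)`.
The proof is the induction (100): covariance of the single-bar average under coarse gauge transformations (✓`Prop8Chart.emlAvgU_gaugeActT`) and the
definition (89) `U̿ = (Ū)^{v⁻¹}` (✓`dbarAvgU_eq_gaugeActT`).

USES.  (J1) of RULING №12 (1): an EX-side twin `dbarTwˢ U₀` built with ACCUMULATED symmetric frames `frameTwˢ` (recursion `_zero`∕`_succ`) specialises at `U₀ = 1` to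
`dbarIterU` BY THIS THEOREM (its `hV0`∕`hVs` are met literally by the recursion lemmas); RULING №13 (i) (D-P1 top clause): §5 is the data identity
`U̿^{(j)}(U^{u}) = (Ū^{(j)}U)^{g}`, `g = V_j⁻¹·(u∘embʲ)`.

WHAT IS PROVED (namespace `…Theorems.Prop8ChartDoubleBar`, generic complete normed `ℂ`-algebra `𝔸`).
* §1 `gaugeActT_gaugeActT` (composition of gauge actions = action of the pointwise product), `gaugeActT_const_one`.
* §2 `dbarAvgU_gaugeActT` — one step on a gauge-transformed field: `U̿(W^{g}) = (Ū W)^{v(W^g)⁻¹·(g∘emb)}`.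
* §3 ★★ `dbarIterU_eq_gaugeActT_emlIterU` (the fundamental equality at background 1, displayed recursion) and the binder-free `exists_accFrames_dbarIterU`.
* §4 `coe_dbarIterU_eq_conj`, ★ `chartLogFlat_eq_conj_emlIterU`: `chartLogFlat η D A (j,c) = (−i)·log(V_j(c₋)⁻¹ · Ū^{(j)}(e^{iηA})(c) · V_j(c₊))`.
* §5 `dbarIterU_gaugeActT_eq` — the same for a coarse-gauge-transformed fine field `U^{us 0}`, `us (i+1) y = us i (emb y)`.
HONEST SCOPE: identities of the formal objects (no smallness, no unitarity); nothing here is specific to `SU(2)`; NOT a claim about the mass gap.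

References: T. Bałaban, CMP **98** (1985) 17–51 [Balaban1985Averaging] ((11) p.19, (78)∕(82) p.30, (85)–(92) p.31, (97)–(100) p.32, (110) p.34, (127) p.36);
CMP **102** (1985) 277–309 [Balaban1985Variational] ((20) p.281, (44) p.285); CMP **109** (1987) 249–301 [Balaban1987RG1] ((0.4), (0.6), (0.11) p.253).
-/

noncomputable section

namespace Summit.QuantumFields.YangMills.Theorems.Prop8ChartDoubleBar

open Literature.MathematicalPhysics.QuantumFieldTheory.Balaban1983to89
open T4Continuum BlockAveraging ExpMeanLog MatrixLog
open B10Eq27TorusAxialLog (holT gaugeActT gaugeActT_apply)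
open B6SectADomainsV1 (Domains)
open B6SectAOperatorsV1 (BondIdx)
open Summit.QuantumFields.YangMills.Theorems.Prop8Chart (expCfg emlAvgU emlIterU emlIterU_zero emlIterU_succ emlAvgU_gaugeActT emlIterU_gaugeActT)

variable {P : Params}

/-! ## §1 Composition of gauge actions -/

section Group

variable {G : Type*} [Group G] {j : ℕ}

/-- **`(W^{b})^{a} = W^{a·b}`**: two successive gauge actions are the action of the pointwise product (the later one on the LEFT). [cite: Balaban1985Averaging, (8) p.19] -/
theorem gaugeActT_gaugeActT (a b : GaugeTransf P j G) (W : GaugeField P j G) :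
    gaugeActT a (gaugeActT b W) = gaugeActT (fun x => a x * b x) W := by
  funext c
  simp only [gaugeActT_apply, mul_inv_rev, mul_assoc]

/-- the trivial gauge transformation acts trivially. [cite: Balaban1985Averaging, (8) p.19] -/
theorem gaugeActT_const_one (W : GaugeField P j G) : gaugeActT (fun _ : Site P j => (1 : G)) W = W := by
  funext c
  rw [gaugeActT_apply, inv_one, one_mul, mul_one]

end Group

variable {𝔸 : Type*} [NormedRing 𝔸] [NormedAlgebra ℂ 𝔸] [CompleteSpace 𝔸]

/-! ## §2 One double-bar step on a gauge-transformed field -/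

/-- **ONE STEP ON A COARSE-GAUGE-TRANSFORMED FIELD**: `U̿(W^{g}) = (Ū W)^{h}` with `h(y) = v(W^{g})(y)⁻¹ · g(emb y)` — (89) `U̿ = (Ū)^{v⁻¹}` composed with the covariance
(11) of the single-bar average. [cite: Balaban1985Averaging, (11) p.19, (89) p.31] -/
theorem dbarAvgU_gaugeActT {j : ℕ} (g : GaugeTransf P j 𝔸ˣ) (W : GaugeField P j 𝔸ˣ) :
    dbarAvgU (gaugeActT g W) = gaugeActT (fun y : Site P (j + 1) => (vframeU (gaugeActT g W) y)⁻¹ * g (emb y)) (emlAvgU W) := by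
  rw [dbarAvgU_eq_gaugeActT, emlAvgU_gaugeActT, gaugeActT_gaugeActT]

/-! ## §3 The fundamental equality (92) at background 1 -/

/-- **PRINT'S FUNDAMENTAL EQUALITY (92)∕(99) AT BACKGROUND 1, FOR THE SYMMETRIC CENTRED OBJECTS**: for every family of ACCUMULATED FRAMES `V j : T^{(j)} → 𝔸ˣ` obeying
(97) — `V 0 = 1` and `V (j+1) y = V j (emb y) · vframeU (dbarIterU j U) y` (the product of the frames of the successive double-bar levels, older on the left) —
the recomputed-frame iterate is the single-bar iterate conjugated by the accumulated frames: `U̿^{(j)} = (Ū^{(j)})^{V_j⁻¹}`, i.e.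
`U̿^{(j)}(c) = V_j(c₋)⁻¹ · Ū^{(j)}(c) · V_j(c₊)` (induction (100)). [cite: Balaban1985Averaging, (92) p.31, (97)-(100) p.32] -/
theorem dbarIterU_eq_gaugeActT_emlIterU (U : GaugeField P 0 𝔸ˣ) (V : (j : ℕ) → Site P j → 𝔸ˣ) (hV0 : ∀ x, V 0 x = 1)
    (hVs : ∀ (j : ℕ) (y : Site P (j + 1)), V (j + 1) y = V j (emb y) * vframeU (dbarIterU j U) y) :
    ∀ j : ℕ, dbarIterU j U = gaugeActT (fun x : Site P j => (V j x)⁻¹) (emlIterU j U)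
  | 0 => by
    have h1 : (fun x : Site P 0 => (V 0 x)⁻¹) = fun _ => 1 := by
      funext x; rw [hV0, inv_one]
    rw [dbarIterU_zero, emlIterU_zero, h1, gaugeActT_const_one]
  | j + 1 => by
    have ih := dbarIterU_eq_gaugeActT_emlIterU U V hV0 hVs j
    rw [dbarIterU_succ, emlIterU_succ]
    conv_lhs => rw [ih]
    rw [dbarAvgU_gaugeActT, ← ih]
    congr 1
    funext y
    rw [hVs j y, mul_inv_rev]

/-- **THE ACCUMULATED FRAMES EXIST (binder-free form)**: the recursion (97) defines them, so `U̿^{(j)} = (Ū^{(j)})^{V_j⁻¹}` for a family `V` with `V 0 = 1`,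
`V (j+1) y = V j (emb y) · v(U̿^{(j)})(y)`. [cite: Balaban1985Averaging, (97) p.32, (92) p.31] -/
theorem exists_accFrames_dbarIterU (U : GaugeField P 0 𝔸ˣ) :
    ∃ V : (j : ℕ) → Site P j → 𝔸ˣ, (∀ x, V 0 x = 1) ∧ (∀ (j : ℕ) (y : Site P (j + 1)), V (j + 1) y = V j (emb y) * vframeU (dbarIterU j U) y) ∧
      ∀ j : ℕ, dbarIterU j U = gaugeActT (fun x : Site P j => (V j x)⁻¹) (emlIterU j U) := by
  let V : (j : ℕ) → Site P j → 𝔸ˣ := fun j => Nat.rec (motive := fun j => Site P j → 𝔸ˣ) (fun _ => 1)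
    (fun j Vj y => Vj (emb y) * vframeU (dbarIterU j U) y) j
  have hV0 : ∀ x, V 0 x = 1 := fun _ => rfl
  have hVs : ∀ (j : ℕ) (y : Site P (j + 1)), V (j + 1) y = V j (emb y) * vframeU (dbarIterU j U) y := fun _ _ => rfl
  exact ⟨V, hV0, hVs, dbarIterU_eq_gaugeActT_emlIterU U V hV0 hVs⟩

/-! ## §4 Values and the chart -/

/-- the bond variables: `U̿^{(j)}(c) = V_j(c₋)⁻¹ · Ū^{(j)}(c) · V_j(c₊)`. [cite: Balaban1985Averaging, (92) p.31] -/
theorem coe_dbarIterU_eq_conj (U : GaugeField P 0 𝔸ˣ) (V : (j : ℕ) → Site P j → 𝔸ˣ) (hV0 : ∀ x, V 0 x = 1)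
    (hVs : ∀ (j : ℕ) (y : Site P (j + 1)), V (j + 1) y = V j (emb y) * vframeU (dbarIterU j U) y) (j : ℕ) (c : PBond P j) :
    ((dbarIterU j U c : 𝔸ˣ) : 𝔸) = (((V j c.src)⁻¹ : 𝔸ˣ) : 𝔸) * ((emlIterU j U c : 𝔸ˣ) : 𝔸) * ((V j c.tgt : 𝔸ˣ) : 𝔸) := by
  rw [dbarIterU_eq_gaugeActT_emlIterU U V hV0 hVs j, gaugeActT_apply, inv_inv, Units.val_mul, Units.val_mul]

/-- **THE DOUBLE-BAR CHART THROUGH THE SINGLE-BAR ITERATE**: `chartLogFlat η D A (j,c) = (−i)·log( V_j(c₋)⁻¹ · Ū^{(j)}(e^{iηA})(c) · V_j(c₊) )` for the accumulated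
frames `V` of the charted field `e^{iηA}` — the (J1)-iterate clause (an accumulated-frame twin at background 1 IS `chartLogFlat`) and the algebraic core of the
top-level data identity. [cite: Balaban1985Variational, (20) p.281, (44) p.285; Balaban1985Averaging, (92) p.31] -/
theorem chartLogFlat_eq_conj_emlIterU (η : ℝ) (D : Domains P) (A : PBond P 0 → 𝔸) (V : (j : ℕ) → Site P j → 𝔸ˣ) (hV0 : ∀ x, V 0 x = 1)
    (hVs : ∀ (j : ℕ) (y : Site P (j + 1)), V (j + 1) y = V j (emb y) * vframeU (dbarIterU j (expCfg η A)) y) (i : BondIdx D) :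
    chartLogFlat η D A i = (-Complex.I) •
      mlog ((((V (i.1.1 : ℕ) i.1.2.src)⁻¹ : 𝔸ˣ) : 𝔸) * ((emlIterU (i.1.1 : ℕ) (expCfg η A) i.1.2 : 𝔸ˣ) : 𝔸) * ((V (i.1.1 : ℕ) i.1.2.tgt : 𝔸ˣ) : 𝔸)) := by
  rw [chartLogFlat_apply, coe_dbarIterU_eq_conj (expCfg η A) V hV0 hVs]

/-! ## §5 A coarse-gauge-transformed fine field -/

/-- **THE DATA IDENTITY FOR `U^{u}`**: for gauge transformations `us i : T^{(i)} → 𝔸ˣ` read at the iterated block centres (`us (i+1) y = us i (emb y)`) and the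
accumulated frames `V` of the transformed field `U^{us 0}`, `U̿^{(j)}(U^{us 0}) = (Ū^{(j)} U)^{g_j}` with `g_j = V_j⁻¹ · us j` — (92) composed with the
covariance (11) of the single-bar iterate (✓`Prop8Chart.emlIterU_gaugeActT`). [cite: Balaban1985Averaging, (11) p.19, (87)-(88) p.31, (92) p.31] -/
theorem dbarIterU_gaugeActT_eq (us : (i : ℕ) → GaugeTransf P i 𝔸ˣ) (hus : ∀ (i : ℕ) (y : Site P (i + 1)), us (i + 1) y = us i (emb y))
    (U : GaugeField P 0 𝔸ˣ) (V : (j : ℕ) → Site P j → 𝔸ˣ) (hV0 : ∀ x, V 0 x = 1)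
    (hVs : ∀ (j : ℕ) (y : Site P (j + 1)), V (j + 1) y = V j (emb y) * vframeU (dbarIterU j (gaugeActT (us 0) U)) y) (j : ℕ) :
    dbarIterU j (gaugeActT (us 0) U) = gaugeActT (fun x : Site P j => (V j x)⁻¹ * us j x) (emlIterU j U) := by
  rw [dbarIterU_eq_gaugeActT_emlIterU (gaugeActT (us 0) U) V hV0 hVs j, emlIterU_gaugeActT us hus U j, gaugeActT_gaugeActT]

/-- its bond variables: `U̿^{(j)}(U^{u})(c) = V_j(c₋)⁻¹·u_j(c₋) · Ū^{(j)}(U)(c) · u_j(c₊)⁻¹·V_j(c₊)`. [cite: Balaban1985Averaging, (88) p.31, (92) p.31] -/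
theorem coe_dbarIterU_gaugeActT_eq (us : (i : ℕ) → GaugeTransf P i 𝔸ˣ) (hus : ∀ (i : ℕ) (y : Site P (i + 1)), us (i + 1) y = us i (emb y))
    (U : GaugeField P 0 𝔸ˣ) (V : (j : ℕ) → Site P j → 𝔸ˣ) (hV0 : ∀ x, V 0 x = 1)
    (hVs : ∀ (j : ℕ) (y : Site P (j + 1)), V (j + 1) y = V j (emb y) * vframeU (dbarIterU j (gaugeActT (us 0) U)) y) (j : ℕ) (c : PBond P j) :
    ((dbarIterU j (gaugeActT (us 0) U) c : 𝔸ˣ) : 𝔸) =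
      (((V j c.src)⁻¹ : 𝔸ˣ) : 𝔸) * ((us j c.src : 𝔸ˣ) : 𝔸) * ((emlIterU j U c : 𝔸ˣ) : 𝔸) * (((us j c.tgt)⁻¹ : 𝔸ˣ) : 𝔸) * ((V j c.tgt : 𝔸ˣ) : 𝔸) := by
  rw [dbarIterU_gaugeActT_eq us hus U V hV0 hVs j, gaugeActT_apply, mul_inv_rev, inv_inv]
  simp only [Units.val_mul, mul_assoc]

end Summit.QuantumFields.YangMills.Theorems.Prop8ChartDoubleBar

end
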